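import Summits.PneNP.PneNP.Theorems.SzkEntropyPeaWorstToAvg
import Literature.Computability.Cryptography.OneWayFunctions
import Literature.Computability.Complexity.AffineHashing

/-!
# Line `dti-errorless-core` for crux `SzkEntropy.PeaWorstToAvg` (stmt-PneNP-10777)

Skeleton (crux-plan, `planner-cruxplan-stmt-PneNP-10777-dti-errorless-core-0`, 2026-08-16).
Route `route-PneNP-SzkEntropy`, crux #3 (hardest); idea card `Ideas/dti-errorless-core.md` (ideator 2,
round 1; triage r1-1/2/3: pass / pass-with-note / pass-with-doubt).  POSITIVE line: `PeaWorstToAvg_of`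
concludes the crux decl BY NAME from the five registered stub statements; `PeaWorstToAvg_proof` applies it
to the sorried stubs.

## The crux (recall)

`PeaWorstToAvg` (over the library's `PEA 3`, `szkEntropy_peaWorstToAvg_iff : … := Iff.rfl`):
`A → C` with `A := PEA 3 ∉ PromiseBPP'` (cubic entropy approximation over `F₂` is worst-case hard for
randomized polynomial time) and `C := ∃ D, D.IsPolySamplable ∧ supp Dₙ ⊆ yes ∪ no ∧ ((PEA 3).yes, D) ∉ HeurBPP`
(two-sided average-case hardness of `PEA₃` itself on a samplable on-promise ensemble).

## The line (lever: decision-to-inversion; the OWF-content of the crux is an ERRORLESS statement)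

`C` implies one-way functions (Ostrovsky 1991), so every proof of the crux proves `SZK_L ⊄ prBPP ⇒ OWF`
on the way; the only worst-case ⇒ OWF technology in print (Hirahara–Nanashima 2024, Liu–Mazor–Pass 2024,
Chakraborty–Hulett–Khurana–Tomer 2026) runs through ERRORLESS average-case hardness plus a
decision-to-inversion reduction.  The line splits the crux at the errorless waypoint:

    PeaWorstToAvg  ⇐  S1 ∧ S2 ∧ S3 ∧ S4 ∧ S5                          [`PeaWorstToAvg_of`]
      A  ──S1──▶  EH := ErrorlessHardIO (PEA 3)                        [worst case ⇒ errorless, i.o., ⊥-rate 1/4]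
      EH + S2 (DTI for the hash-threshold family of p^{×|I|})
         ──S3──▶  ∃ f, io-weakly one-way   ──S4──▶  ∃ f, IsIOOneWay f   [bridge + Yao, i.o. reading]
      (∃ f, IsIOOneWay f) ∧ EH ∧ A  ──S5──▶  C                          [residual: errorless ⇒ two-sided, in io-Minicrypt]

S1 and S5 are NECESSARY for the crux (crux ⇒ S5 because `EH ⇒ A`, the errorless analogue of the landed
`szkEntropy_peaWorstToAvg_converse`; S1 is the crux's conclusion weakened from two-sided to errorless, at
constant rate), S2–S4 are unconditional theorems to be formalised (S2 new and PEA-native; S3 = the LMP24 /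
CHKT26 bridge in the i.o. pairing; S4 = Goldreich Thm 2.3.2 read infinitely-often).  S1 ∧ S2 ∧ S3 ∧ S4 alone
prove `PEA₃ ∉ prBPP' ⇒ ∃ f, IsIOOneWay f`, i.e. (io-)one-way functions from the worst-case hardness of
`SZK_L` — the upgrade of Ostrovsky–Wigderson 1993 (auxiliary-input OWF) that three triagers singled out as
the deliverable of this line; S5 is the honest residual (card K4, "structure from OWF", black-box-blocked by
Bitansky–Degwekar–Vaikuntanathan 2021) and is flagged as this line's costume risk in the line card.

PAIRING (deviation from the card, forced by the crux's hypothesis): the card paired ALMOST-EVERYWHERE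
errorless hardness with `OWFExist`; but `A` is an infinitely-often hypothesis, and "PEA₃ easy exactly on an
explicit sparse family of polynomially wide length windows" is consistent with `A` and with `C` yet refutes
a.e. errorless hardness of every samplable ensemble — so the a.e. form is NOT implied by the crux.  Here every
hardness statement is infinitely-often and the bridge concludes `∃ f, IsIOOneWay f`; the uniformity-in-`m`
problem of i.o. bridges (one errorless SCHEME for all failure parameters from a family of inverters) is
dissolved by stating errorless hardness at CONSTANT ⊥-rate `1/4` (`ErrorlessHardIO`), which is also exactly
what a Hirahara-2018-type hitting-set argument delivers (a dense errorless test).  The conjecture constants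
`OWFExist` / `IOOWFExist` are deliberately not named (route cone hygiene): `∃ f, IsIOOneWay f` is spelled out.

MODEL CLAUSES (the tree's `RandAlg` has an arbitrary, uncomputable coin budget `coinLen`; cf.
`Theorems/SzkEntropyPeaWorstToAvgAdviceLeak.lean`, Disproof §5, `YaoAmplification.lean`,
`HeuristicClassesHeurBPPReductionProofs.lean`): `ErrorlessHardIO` asks the hard ensemble to be
LENGTH-REGULAR (`|x| = L n` on `supp Dₙ`, `L` strictly increasing — so the input length of a parametrised
algorithm determines `(|x|, n)` on the support and can carry the O(1) uncomputable coin counts of its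
subroutines), and `IsPolyTimeFamily` asks the inversion family to have output length `λ(|I|)`; both are free
for the constructions S1/S2 must give anyway (pad), and they are what makes S3 provable in this model.

## Disproof used

`payload.disproof_path` (`run/gate/evidence/stmt-PneNP-10777/20260815T224102Z-Disproof.lean`) is not mounted
on this hub and `Cruxes/PeaWorstToAvg/Disproof.lean` has not been crux-written (same finding as all three
triagers); used: the disprover's evidence notes on the item (cdisprove cycle 1, §§1–6) and the landed
`Theorems/SzkEntropyPeaWorstToAvg.lean`.  (a) NO `_false_without_<H>` theorem exists or can exist (§3: the
only hypothesis is `A`; "WithoutA ↔ A ∧ S"); `A` is consumed by `stub_worstToErrorless` only.  (b) Refuted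
strengthenings honoured: the ∀-ensemble version (junk point mass, §4) — every stub is `∃ D`; one-sided supports
are `HeurBPP`-easy (`mem_HeurBPP_of_support_disjoint/subset`, §4) — the `D₀` of S1 and the `D` of S5 must carry
yes- AND no-mass (recorded in the card; nothing in the statements forces one-sidedness); degree dial `d = 0`
vacuous — irrelevant at `d = 3`.  (c) §5 advice leak (`PSamp`/`HeurBPP` carry `O(log)` advice via `coinLen`,
`PromiseBPP'` is uniform): S1's proof cannot be a black-box simulation of a heuristic inside a `PromiseBPP'`
machine without advice elimination — consistent with the intended NON-black-box (Hirahara-type) attack; the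
model clauses above are this line's answer on the constructive side (S3/S4).  (d) §6 domination barrier
(`card_le_of_dominated_of_disjoint_supports`: entropy-exact / GL-orbit / direct-sum self-reductions serve
only `poly(n)` invariant classes): not engaged — no stub re-randomises instances inside an orbit; S1 asks for a
hitting-type (one-sided) use of an errorless heuristic, S2 inverts the instance's OWN map.  No
`Theorems/PeaWorstToAvg/Negative/` lemma has landed (`ledger crux ls`; tree listing), so there is nothing to
import-check the stubs against; `ledger negatives --problem PneNP`: 5 items, none related (triage r1-1/2/3).
-/

set_option linter.dupNamespace false

namespace Summit.PneNP.PneNP.Cruxes.PeaWorstToAvg.DtiErrorlessCore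

open Literature.Computability.Complexity Literature.Computability.MetaComplexity
open Literature.Computability.Cryptography
open _root_.Computability Filter

noncomputable section

/-! ## Vocabulary of the line (over `HeuristicClasses`, `DistProblems`, `OneWayFunctions`, `Randomized`) -/

/-- The ensemble is supported on the promise of `Q` (verbatim the crux's support clause). -/
def OnPromise (Q : PromiseProblem) (D : Ensemble) : Prop :=
  ∀ n : ℕ, ∀ w ∈ (D n).support, w ∈ Q.yes ∨ w ∈ Q.no

/-- **Length-regular ensemble**: every string in `supp Dₙ` has length exactly `L n`, for a strictly
increasing `L` (so `n ≤ L n`, and `n ↦ |⟨x, 1ⁿ⟩| = 2 L n + n + 2` is injective on the support).  Model clause,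
see the module docstring; free for padded constructions. -/
def LengthRegular (D : Ensemble) : Prop :=
  ∃ L : ℕ → ℕ, StrictMono L ∧ ∀ n : ℕ, ∀ w ∈ (D n).support, w.length = L n

/-- `A` is ERRORLESS for `Q` on the support of `D`: on every `x ∈ supp Dₙ` the probability (over `A`'s coins)
of the WRONG non-`⊥` verdict about `x ∈ Q.yes` is `≤ 1/4` — the pointwise clause (i) of Bogdanov–Trevisan's
`AvgBPP` (Def. 2.11), for a single-parameter algorithm `A(x, 1ⁿ) ∈ {0,1,⊥}` (input `paramEnc`). -/
def IsErrorlessOn (Q : PromiseProblem) (D : Ensemble) (A : RandAlg (List Bool × ℕ) (Option Bool)) : Prop :=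
  ∀ n : ℕ, ∀ x ∈ (D n).support, A.pr paramEnc (x, n) {some (!(Q.yes.boolIndicator x))} ≤ 1 / 4

/-- **`ErrorlessHardIO Q`** — INFINITELY-OFTEN ERRORLESS HARDNESS OF `Q` ITSELF AT CONSTANT RATE: there is a
polynomial-time samplable, length-regular ensemble `D` supported on the promise of `Q` such that every
probabilistic polynomial-time `{0,1,⊥}`-valued algorithm that is errorless on `supp D` leaves, for
infinitely many `n`, more than a quarter of the `Dₙ`-mass `⊥`-heavy (`Pr_coins[⊥] ≥ 1/4`).  Between the
card's K1 (`((Q.yes), D) ∉ AvgBPP`, which it implies: take the scheme at `m = 4`) and the card's a.e. form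
`ErrorlessHardAE` (which it does not claim).  [BogdanovTrevisan2006 Def. 2.11; Chakraborty–Hulett–Khurana–Tomer
2026 (arXiv:2602.17651) Def. 9, negated and made uniform; Hirahara 2018 Thm I.1 for the shape of what
non-black-box reductions deliver] -/
def ErrorlessHardIO (Q : PromiseProblem) : Prop :=
  ∃ D : Ensemble, D.IsPolySamplable ∧ OnPromise Q D ∧ LengthRegular D ∧
    ∀ A : RandAlg (List Bool × ℕ) (Option Bool), A.IsPolyTime paramEnc optBoolEnc →
      IsErrorlessOn Q D A →
        ∃ᶠ n in atTop, (1 : ℝ) / 4 < D.prob n {x | 1 / 4 ≤ A.pr paramEnc (x, n) {none}}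

/-- Success probability of `A` at inverting the instance-indexed function `fam I` on a uniform input of length
`ℓ(|I|)`, GIVEN the instance: `Pr_{z ← U_{ℓ(|I|)}, coins}[fam I (A ⟨I, fam I z⟩) = fam I z]` (any preimage
counts; `A`'s input is `boolPair I (fam I z)`). -/
def instInvertProb (fam : List Bool → List Bool → List Bool) (ℓ : Polynomial ℕ)
    (A : RandAlg (List Bool) (List Bool)) (I : List Bool) : ℝ :=
  uniformAvg (ℓ.eval I.length) fun z => A.pr id (boolPair I (fam I z)) {w | fam I w = fam I z}

/-- **Decision-to-inversion reduction** for `Q` along the instance-indexed family `fam` (coin length `ℓ`,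
quality `q₀`): every PPT `A` that inverts `fam I` with probability `≥ 1 − 1/q₀(|I|)` on a promise instance `I`
yields a PPT decider `B` correct on `I` with probability `≥ 2/3`.  `∀ A ∃ B` form (B may depend non-uniformly
on `A`, as every reduction in the tree's `RandAlg` model must).  [Chakraborty–Hulett–Khurana–Tomer 2026
Def. 10, after Liu–Mazor–Pass 2024; here instance-wise] -/
def DecisionToInversion (Q : PromiseProblem) (fam : List Bool → List Bool → List Bool)
    (ℓ q₀ : Polynomial ℕ) : Prop :=
  ∀ A : RandAlg (List Bool) (List Bool), IsPPT A id →
    ∃ B : RandAlg (List Bool) Bool, IsPPT B encodeBool ∧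
      ∀ I : List Bool, (I ∈ Q.yes ∨ I ∈ Q.no) →
        1 - 1 / ((q₀.eval I.length : ℕ) : ℝ) ≤ instInvertProb fam ℓ A I →
          (I ∈ Q.yes → 2 / 3 ≤ B.pr id I {true}) ∧ (I ∈ Q.no → 2 / 3 ≤ B.pr id I {false})

/-- **Polynomial-time, length-regular family**: `(I, z) ↦ (I, fam I z)` is computed by ONE polynomial-time
string function on the pairs `boolPair I z` with `|z| = ℓ(|I|)`, and the output length is `λ(|I|)` there
(model clause: all inversion queries about instances of one length have one length). -/
def IsPolyTimeFamily (fam : List Bool → List Bool → List Bool) (ℓ lam : Polynomial ℕ) : Prop :=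
  (∃ F : List Bool → List Bool, PolyTimeComputable id id F ∧
      ∀ I z : List Bool, z.length = ℓ.eval I.length → F (boolPair I z) = boolPair I (fam I z)) ∧
    ∀ I z : List Bool, z.length = ℓ.eval I.length → (fam I z).length = lam.eval I.length

/-- `f` is INFINITELY-OFTEN WEAKLY one-way with hardness polynomial `q`: polynomial-time computable, and
every PPT inverter has success `≤ 1 − 1/q(n)` for infinitely many `n` (Goldreich Def. 2.2.2 read i.o.; the
inverter gets `(1ⁿ, f x)` as in `invertProb`). -/
def IsIOWeaklyOneWayAt (q : Polynomial ℕ) (f : List Bool → List Bool) : Prop :=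
  PolyTimeComputable id id f ∧
    ∀ A : RandAlg (List Bool) (List Bool), IsPPT A id →
      ∃ᶠ n in atTop, invertProb f A n ≤ 1 - 1 / ((q.eval n : ℕ) : ℝ)

/-! ## The PEA-native inversion family: hash thresholds of the `|I|`-fold power of the instance's own map

For a promise instance `I` (the encoding of `(n, p, k)`, `p : F₂ⁿ → F₂^m` cubic, sparse) put `L := |I|`,
`t := L` and let `s ≤ L` be the number of variable indices occurring in `p`.  On `z ∈ {0,1}^{ℓ(L)}`,
`ℓ(L) = L⁴ + 2L² + L`, read: an `X`-field of `L²` bits (= `t` blocks of `L` bits; block `r` gives the values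
of the `s` used variables of the `r`-th copy, the other bits are padding), an affine hash `h = (M, b)`,
`M ∈ F₂^{L²×L²}` (`L⁴` bits), `b ∈ F₂^{L²}`, and a level field of `L` bits, `j := (its value) mod (L² + 1)`.
Output (length `λ(L) = L⁴ + 3L² + L`): the `t` images `p(x_r)` (padded to `L²` bits), `M`, `b`, the raw
level field, and `h(X)` with the coordinates `≥ j` zeroed.  INVERTING `fam I` at a random point = producing
`X'` with the same `t` images whose hash agrees with a given value on the first `j` coordinates: feasible
information-theoretically iff `2^j ≲ |fibre|`, and a failure at level `j ≫ log₂|fibre|` is CHECKABLE —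
so a near-perfect inverter reads off `log₂|fibre_t(y)| ± O(log L)` for typical `y`, hence
`t·(s' − H(p)) ± o(t)` on average (`s'` = number of free input bits), and decides `H ≥ k+1` vs `H ≤ k`
(gap `t = L`).  [Impagliazzo–Luby 1989 §4 (the hashed function `(f x, h, h(x)↾i)`); Jerrum–Valiant–Vazirani
1986 / Sipser–Stockmeyer hashing (tree: `AffineHash.card_exists_hash_le/ge`); DGRV 2010 §3 (`H(pᵗ) = t·H(p)`,
tree `PolyMapF2.entropy_prod`)] -/

namespace PeaFam

/-- Bit `i` of `z`, `false` beyond the end (so `fam I` is total and depends on `z` only through its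
`ℓ(|I|)`-bit prefix padded with zeros). -/
def bit (z : List Bool) (i : ℕ) : Bool := z.getD i false

/-- `Bool ↪ F₂`. -/
def toZ (b : Bool) : ZMod 2 := if b then 1 else 0

/-- `F₂ → Bool`. -/
def ofZ (a : ZMod 2) : Bool := decide (a = 1)

/-- Pad with `false` / truncate to length exactly `n`. -/
def fit (n : ℕ) (l : List Bool) : List Bool := (l ++ List.replicate n false).take n

/-- Value of a list of bits, little-endian. -/
def bitsVal (l : List Bool) : ℕ := l.foldr (fun b acc => (if b then 1 else 0) + 2 * acc) 0

/-- The variable indices occurring in the sparse map `P`, increasing, without repetition. -/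
def usedVars {n : ℕ} (P : PolyMapF2 n) : List (Fin n) :=
  ((P.flatMap fun q => q.flatMap id).toFinset).sort (· ≤ ·)

/-- The point of `F₂ⁿ` described by a block of bits `u`: the `c`-th used variable of `P` (increasing order)
gets `u c`, unused variables are `0` (they do not affect `P.eval`). -/
def point {n : ℕ} (P : PolyMapF2 n) (u : ℕ → Bool) : Fin n → ZMod 2 :=
  fun i => if i ∈ usedVars P then toZ (u ((usedVars P).idxOf i)) else 0

/-- Coin length `ℓ(L) = L⁴ + 2L² + L` of the family (as a polynomial, for `instInvertProb`). -/
def coinLen : Polynomial ℕ := Polynomial.X ^ 4 + 2 * Polynomial.X ^ 2 + Polynomial.X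

/-- Output length `λ(L) = L⁴ + 3L² + L` of the family. -/
def outLen : Polynomial ℕ := Polynomial.X ^ 4 + 3 * Polynomial.X ^ 2 + Polynomial.X

/-- The record output by the family on a DECODED instance map `P` with `L = |I|`: images of the `L` blocks,
the hash description, the raw level field, and the masked hash value of the whole `X`-field. -/
def record {n : ℕ} (P : PolyMapF2 n) (L : ℕ) (z : List Bool) : List Bool :=
  let N := L * L
  let xbit : ℕ → Bool := fun c => bit z c                                   -- X-field: positions [0, N)
  let M : Matrix (Fin N) (Fin N) (ZMod 2) :=
    Matrix.of fun i j => toZ (bit z (N + i.val * N + j.val))              -- M-field: [N, N + N²)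
  let bvec : Fin N → ZMod 2 := fun i => toZ (bit z (N + N * N + i.val))   -- b-field: [N + N², 2N + N²)
  let jraw : List Bool := (List.range L).map fun c => bit z (2 * N + N * N + c)  -- level field: L bits
  let j : ℕ := bitsVal jraw % (N + 1)
  let xvec : Fin N → ZMod 2 := fun c => toZ (xbit c.val)
  let hx : Fin N → ZMod 2 := AffineHash.hash (M, bvec) xvec
  let ybits : List Bool :=
    (List.range L).flatMap fun r => (P.eval (point P fun c => xbit (r * L + c))).map ofZ
  fit N ybits ++ (List.range (N * N)).map (fun c => bit z (N + c)) ++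
    (List.range N).map (fun c => bit z (N + N * N + c)) ++ jraw ++
    (List.finRange N).map fun i => if i.val < j then ofZ (hx i) else false

/-- **The family** `fam I z`: decode `I` as a `PEA` instance `(n, p, k)` (`PEAInst.encoding`) and output the
record of `p`; on undecodable `I` output `λ(|I|)` zeros. -/
def fam (I z : List Bool) : List Bool :=
  match PEAInst.encoding.decode I with
  | some inst => record inst.2.1 I.length z
  | none => List.replicate (outLen.eval I.length) false

end PeaFam

/-! ## The five registered stubs -/

/-- **S1 · `stub_worstToErrorless` — HARDEST, load-bearing (card K1, i.o. form at constant rate).**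
Worst-case hardness of `PEA₃` for randomized polynomial time gives infinitely-often ERRORLESS hardness of
`PEA₃` ITSELF, at `⊥`-rate `1/4`, on some polynomial-time samplable, length-regular, promise-supported
ensemble `D₀` of cubic-map instances.  Necessary direction of travel: the crux's `C` gives `∉ AvgBPP`
(`AvgBPP_subset_HeurBPP_holds`) on the same `D`; what S1 adds is (i) errorless instead of two-sided — the
form in which Hirahara-type non-black-box reductions (dense errorless tests break hitting-set generators;
reconstruction) can be attempted, failure sets being recognisable — and (ii) the constant rate.  Known one
level off: `PEA₃ ∉ prBPP ⇒ SZK ⊄ BPP ⇒ DistNP ⊄ AvgP` (Hirahara 2018 Thm I.1 + Allender–Das; AGHR 2023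
Cor. 37); open: landing the hard errorless ensemble ON `PEA₃` instances (ideator barrier note B4).  With
S2–S4 this stub alone yields `PEA₃ ∉ prBPP' ⇒ ∃ f, IsIOOneWay f`.  Uses the crux hypothesis `A` (the only
load-bearing hypothesis per Disproof §3).  Why it might fail: an `SZK_L`-Heuristica for errorless heuristics
(PEA₃ hard only on instances no sampler reaches with constant mass) is excluded by nothing known; the proof
must be non-black-box AND advice-eliminating (Disproof §5).  [DvirGutfreundRothblumVadhan2010 pp. 2–3;
Hirahara 2018 (FOCS) Thm I.1; AllenderGouwarHiraharaRobelle2023 Cor. 37; HiraharaNanashima2024;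
BogdanovTrevisan2006 Def. 2.11] -/
theorem stub_worstToErrorless : PEA 3 ∉ PromiseBPP' → ErrorlessHardIO (PEA 3) := by
  sorry

/-- **S2 · `stub_peaDTI` — decision-to-inversion for `PEA₃` along its OWN hash-threshold family (card K2,
made specific as triage r1-2 asked).**  (a) `PeaFam.fam` is a polynomial-time, length-regular family
(`IsPolyTimeFamily … PeaFam.coinLen PeaFam.outLen`: a TM2 evaluator for sparse cubic maps — shared with the
route's support item `PeaMemPH`, stmt-PneNP-10779 — plus an `F₂` matrix–vector product and fixed-layout
field plumbing; the length clause is immediate from `PeaFam.fit`); (b) for some polynomial `q₀ > 0`, every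
PPT `A` inverting `fam I` with probability `≥ 1 − 1/q₀(|I|)` on a promise instance `I` yields a PPT `B`
deciding `I` w.p. `≥ 2/3`: `B` samples `X`, and for each level `j` tests whether `A` still inverts when the
masked hash value is replaced by FRESH RANDOM bits — it must while `2^j ≤ |fibre|/poly` (the true and the
random query are statistically close: leftover hashing on `X` uniform in its fibre) and it cannot once
`2^j ≥ poly·|fibre|` (no consistent preimage exists: union bound `AffineHash.card_exists_hash_le`; success is
verified by re-evaluating `fam`), so the largest passing level is `log₂|fibre_t| ± O(log L)` for all but a
`O(L⁴/q₀)`-fraction of samples; averaging `O(L²)` samples estimates `t·(L² − s·t… ) − t·H(p)` — precisely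
`E[log₂|fibre|] = (#free input bits) − t·H(p)` with `t = L`, `H(pᵗ) = t·H(p)` (`PolyMapF2.entropy_prod`) and
unused variables / padding bits contributing known constants — to within `< t/2`, which separates
`H ≥ k + 1` from `H ≤ k`; instances shorter than a constant `L₀` are decided by table.  Unconditional and
instance-wise (no vacuity in Cryptomania: linear instances make the premise satisfiable at every length).
Why it might fail: only formally — the estimate needs the inverter's CONDITIONAL failure at each of the
`L² + 1` levels, bought by `q₀ ≫ L⁴` (each level has probability `≥ 1/(2(L²+1))` under the level field), and
exact bookkeeping of the padding bits in `|fibre|`.  Size L (math) + XL (machines).  [ImpagliazzoLuby1989 §4;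
JerrumValiantVazirani1986; AroraBarak2009 Claim 8.16.1 (tree `AffineHashing.lean`);
DvirGutfreundRothblumVadhan2010 §3 p. 6] -/
theorem stub_peaDTI :
    IsPolyTimeFamily PeaFam.fam PeaFam.coinLen PeaFam.outLen ∧
      ∃ q₀ : Polynomial ℕ, (∀ n, 0 < q₀.eval n) ∧
        DecisionToInversion (PEA 3) PeaFam.fam PeaFam.coinLen q₀ := by
  sorry

/-- **S3 · `stub_errorlessBridge` — the bridge (card K3), i.o. pairing, generic in the promise problem.**
If `Q` is i.o.-errorless-hard at constant rate on a samplable length-regular on-promise ensemble `D` (sampler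
`S`, coin bound `p_c`) and has a decision-to-inversion reduction along a polynomial-time length-regular
family `fam`, then SOME polynomial-time function is infinitely-often weakly one-way.  Proof (contrapositive,
after Liu–Mazor–Pass 2024 Lemma 3.1 / CHKT26 Lemma 2 & App. B): take
`F'(w) = ⟨n, g, I, fam I z'⟩` on `|w| = N`, reading from `w` a parameter field `n < N`, a GUESS `g ≤ p_c(n)` for
the sampler's (uncomputable) coin count, coins `r` (`I := S(1ⁿ; r↾g)`) and `z' = z↾ℓ(|I|)`; if no poly-time
function is i.o.-weakly one-way, `F'` has for `q := 16·q₀·(slice density)⁻¹` a PPT inverter succeeding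
`> 1 − 1/q(N)` at ALL large `N`, hence (conditioning on the slice `n`-field `= n`, `g = coinLen_S(n)`, of
density `≥ 1/poly`) a near-perfect inverter of `fam I` for all but a `1/(16 q₀)`… fraction of `I ∼ Dₙ`, at
every large `n`; the instance inverter `A'(⟨I, y⟩)` enumerates the polynomially many candidate framings
`(n, g)` (`n ≤ |I|` by length-regularity), pads every query to ONE length `G(|⟨I,y⟩|)` and keeps a VERIFIED
preimage (re-evaluate `fam` through `F`), so it is a single PPT whose coin budget carries the one
uncomputable digit `coinLen_A(G(·))`; `B := DTI(A')`; the errorless algorithm `E(x, 1ⁿ)` estimates `A'`'s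
success on `I = x` by sampling (threshold `1 − 3/(4q₀)`, accuracy `1/(4q₀)`, triage r1-1), runs `B`
(majority of `O(1)` runs) if it passes and outputs `⊥` otherwise — errorless on `supp Dₙ ⊆ promise` at EVERY
`n` (the DTI guarantee is instance-wise), `⊥`-heavy on `≤ 1/8 + o(1) < 1/4` of `Dₙ` at every large `n`
(Markov), and polynomial-time in the model because `|⟨x, 1ⁿ⟩|` determines `(|x|, n)` on the support
(length-regularity) so `E`'s coin budget carries `coinLen_{A}` and `coinLen_B(|x|)` — contradicting
`ErrorlessHardIO`.  Why it might fail: only formally (XL in the tree's machine model: three nested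
constructed `RandAlg`s with packed coin counts, as in `YaoAmplification.lean` / `CommitmentOneWay.lean`).
[LiuMazorPass2024 (ePrint 2024/800) Lemma 3.1; arXiv:2602.17651 Def. 9–10, Lemma 2, App. B;
BogdanovTrevisan2006 Def. 2.11; Goldreich2001 §2.2.3] -/
theorem stub_errorlessBridge :
    ∀ (Q : PromiseProblem) (fam : List Bool → List Bool → List Bool) (ℓ lam q₀ : Polynomial ℕ),
      (∀ n, 0 < q₀.eval n) → IsPolyTimeFamily fam ℓ lam → DecisionToInversion Q fam ℓ q₀ →
        ErrorlessHardIO Q →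
          ∃ (f : List Bool → List Bool) (q : Polynomial ℕ), (∀ n, 0 < q.eval n) ∧ IsIOWeaklyOneWayAt q f := by
  sorry

/-- **S4 · `stub_ioYao` — Yao's amplification, infinitely-often reading (known in print).**  An i.o.-weakly
one-way function gives an i.o.-(strongly) one-way function: length-regularise `f` (pad `f x` to length
exactly `P(|x|)`, `P` strictly increasing — inverters transfer at the same lengths, Goldreich §2.2.3), then take
the direct product `g = f^{×t(n)}`, `t(n) = n·q(n)`, exactly as in the tree's `YaoAmplification.lean`
(`Yao.Params.g`); if some PPT `B` inverts `g` with probability `> m^{-c}` at ALL large `m`, Goldreich's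
reduction (Claims 2.3.2.1–2) inverts `f` with probability `> 1 − 1/q(n)` at ALL large `n` — the a.e. reading
needs no sparse set of block lengths because, `f` being length-regular with injective `P`, the input length
`2n + 2 + P(n)` of the reduction determines `n`, so its coin budget carries `coinLen_B` at the one query length
`M(n)` for every `n`.  Why it might fail: cannot mathematically (Goldreich 2001 Thm 2.3.2, proof read on the
page by the tree's Yao files); XL formal (re-run of `YaoAmplification`/`YaoInvProgram` without `seqN`).
[Goldreich2001 Thm 2.3.2, §2.3.1, Prop. 2.2.5; Yao1982; HiraharaLuOliveira2024 Def. 10] -/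
theorem stub_ioYao :
    (∃ (f : List Bool → List Bool) (q : Polynomial ℕ), (∀ n, 0 < q.eval n) ∧ IsIOWeaklyOneWayAt q f) →
      ∃ f : List Bool → List Bool, IsIOOneWay f := by
  sorry

/-- **S5 · `stub_errorlessToHeur` — the RESIDUAL (card K4, weakened): errorless ⇒ two-sided, in io-Minicrypt.**
Given infinitely-often one-way functions, an i.o.-errorless-hard samplable on-promise ensemble on `PEA₃`,
and the worst-case hypothesis `A` itself (listed explicitly although `EH ⇒ A` is provable — the errorless
analogue of `szkEntropy_peaWorstToAvg_converse` — so that nothing hidden is asked of the prover), produce a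
samplable on-promise ensemble on which `PEA₃` is TWO-SIDED hard (`∉ HeurBPP`) — the crux's conclusion `C`
verbatim.  NECESSARY for the crux (`stub_errorlessToHeur_of_crux` below, sorry-free: the crux implies S5)
and strictly weaker than it unless S1–S4 are known; it isolates
the 'structure from OWF' half: with OWF in hand one has PRGs/commitments, with EH a hard errorless core to
start from, and `PEA₃` is `SZK_L`-complete with instance-dependent commitments (Ong–Vadhan) and is closed
under complement up to Karp reductions.  HONEST STATUS (triage r1-1 note 2, r1-2, r1-3: "K4 ≈ the crux
restricted to Minicrypt; the line's value is K1"): no mechanism is claimed; fully black-box use of the OWF is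
impossible (no `SZK`-hardness from OWF black-box: Bitansky–Degwekar–Vaikuntanathan 2021), so a proof must use
`EH`/`A` again (errorless-to-two-sided conversion needs certificates: ideator barrier note B5) or the specific
log-space-flavoured OWF of S3; nearest analogue in print: Hirahara–Lu–Oliveira 2024 Thm 3 (for `pKt`,
`∃ io-OWF ⟺` a two-sided-to-one-sided error reduction).  Why it might fail: false in a world with io-OWF and
an errorless-hard but two-sided-easy `PEA₃` (errorless `SZK_L`-Pessiland inside Minicrypt) — not excluded.
[BitanskyDegwekarVaikuntanathan2021; Ostrovsky1991; OngVadhan2008; HiraharaLuOliveira2024 Thm 3;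
BogdanovTrevisan2006 Def. 2.11–2.13; ImpagliazzoLevin1990] -/
theorem stub_errorlessToHeur :
    (∃ f : List Bool → List Bool, IsIOOneWay f) → ErrorlessHardIO (PEA 3) → PEA 3 ∉ PromiseBPP' →
      ∃ D : Ensemble, D.IsPolySamplable ∧
        (∀ n : ℕ, ∀ w ∈ (D n).support, w ∈ (PEA 3).yes ∨ w ∈ (PEA 3).no) ∧
        (⟨(PEA 3).yes, D⟩ : DistProblem) ∉ HeurBPP := by
  sorry

/-! ## Names for the five statements (hypotheses of the composition)

The skeleton audit admits, as hypotheses of the theorem that concludes the crux, only registered obligations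
or the declared stubs BY NAME; `Statement.stub_x` is the statement of `stub_x` (its `type_of%`) under the
stub's own short name (pattern of `Cruxes/KappaExplicitWaveDecay/Lines/extremal-corner-blowup.lean`). -/

namespace Statement

/-- Statement of `stub_worstToErrorless` (S1). -/
abbrev stub_worstToErrorless : Prop := type_of% DtiErrorlessCore.stub_worstToErrorless
/-- Statement of `stub_peaDTI` (S2). -/
abbrev stub_peaDTI : Prop := type_of% DtiErrorlessCore.stub_peaDTI
/-- Statement of `stub_errorlessBridge` (S3). -/
abbrev stub_errorlessBridge : Prop := type_of% DtiErrorlessCore.stub_errorlessBridge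
/-- Statement of `stub_ioYao` (S4). -/
abbrev stub_ioYao : Prop := type_of% DtiErrorlessCore.stub_ioYao
/-- Statement of `stub_errorlessToHeur` (S5). -/
abbrev stub_errorlessToHeur : Prop := type_of% DtiErrorlessCore.stub_errorlessToHeur

end Statement

/-! ## Sanity certificates (sorry-free) -/

/-- `fit n l` has length exactly `n`. -/
theorem PeaFam.length_fit (n : ℕ) (l : List Bool) : (PeaFam.fit n l).length = n := by
  simp only [PeaFam.fit, List.length_take, List.length_append, List.length_replicate]
  omega

/-- The family is length-regular by construction: `|fam I z| = λ(|I|)` for EVERY `z` (the easy half of the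
`IsPolyTimeFamily` conjunct of S2; also a sanity check of the field layout). -/
theorem PeaFam.length_fam (I z : List Bool) : (PeaFam.fam I z).length = PeaFam.outLen.eval I.length := by
  have hout : PeaFam.outLen.eval I.length = I.length ^ 4 + 3 * I.length ^ 2 + I.length := by
    simp [PeaFam.outLen]
  unfold PeaFam.fam
  cases PEAInst.encoding.decode I with
  | none => simp
  | some inst =>
    simp only [PeaFam.record, List.length_append, PeaFam.length_fit, List.length_map,
      List.length_range, List.length_finRange, hout]
    ring

/-- **The residual is implied by the crux** (so at S5 the line never asks for more than the crux itself):
`PeaWorstToAvg → S5`, sorry-free.  Together with `PeaWorstToAvg_of`: given the unconditional S2–S4, the crux is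
EQUIVALENT to `S1' ∧ S5` for any `S1'` between the crux's errorless shadow and S1. -/
theorem stub_errorlessToHeur_of_crux (h : Summit.PneNP.PneNP.Theses.SzkEntropy.PeaWorstToAvg) :
    Statement.stub_errorlessToHeur :=
  fun _ _ hA => Summit.PneNP.PneNP.Theorems.szkEntropy_peaWorstToAvg_iff.1 h hA

/-! ## The composition (kernel-checked, sorry-free) -/

/-- **`PeaWorstToAvg_of`** — the five stub STATEMENTS imply the crux, BY NAME.  From `A`: S1 gives the
errorless-hard ensemble `EH`; S2 (family + DTI) and S3 give an i.o.-weakly one-way function; S4 makes it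
i.o.-one-way; S5 turns `io-OWF ∧ EH ∧ A` into the crux's conclusion `C`; `szkEntropy_peaWorstToAvg_iff` (`Iff.rfl`)
identifies the route's inline spelling with the library's `PEA 3`. -/
theorem PeaWorstToAvg_of (h₁ : Statement.stub_worstToErrorless) (h₂ : Statement.stub_peaDTI)
    (h₃ : Statement.stub_errorlessBridge) (h₄ : Statement.stub_ioYao)
    (h₅ : Statement.stub_errorlessToHeur) :
    Summit.PneNP.PneNP.Theses.SzkEntropy.PeaWorstToAvg := by
  refine Summit.PneNP.PneNP.Theorems.szkEntropy_peaWorstToAvg_iff.2 fun hA => ?_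
  have hEH : ErrorlessHardIO (PEA 3) := h₁ hA
  obtain ⟨hfam, q₀, hq₀, hdti⟩ := h₂
  obtain ⟨f, q, hq, hweak⟩ := h₃ (PEA 3) PeaFam.fam PeaFam.coinLen PeaFam.outLen q₀ hq₀ hfam hdti hEH
  exact h₅ (h₄ ⟨f, q, hq, hweak⟩) hEH hA

/-- The crux along this line, MODULO the five registered stubs (references every `stub_*`, so the skeleton
audit shows exactly which sorries `PeaWorstToAvg` still depends on; the lead closes the crux by discharging
them). -/
theorem PeaWorstToAvg_proof : Summit.PneNP.PneNP.Theses.SzkEntropy.PeaWorstToAvg :=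
  PeaWorstToAvg_of stub_worstToErrorless stub_peaDTI stub_errorlessBridge stub_ioYao stub_errorlessToHeur

end

end Summit.PneNP.PneNP.Cruxes.PeaWorstToAvg.DtiErrorlessCore
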